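import Literature.MathematicalPhysics.QuantumFieldTheory.Balaban1983to89.B13Sect1Arith

/-!
# NODE O port — F-vocabulary (c), part FH: THE `H_k`-FUNCTIONAL INTERFACE OF RECORD (`𝔅`, F_H-1∕F_H-2 as Props over `𝔅`, the s-decoupled edition,
# the construction statement (C-FW), the F4 map row on a guarded ball) — HOISTED from ◇ lens-1 g17's v24 sketch, with ◆ CRIT-1 g40's (w6)(w7)

Definition pen `pub-ymgap-node00-def-Y` (g41), docket ★★★ director-ym №649 (2)∕(3), №652 (2)(3) («def-Y (c) = hoist `FHOps`∕`FHOps.Bounds`∕`DSolves`∕`DAnalyticBound`∕`FH1`∕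
`A0Solves`∕`A0AnalyticBound`∕`FH2`∕`hk`∕`SFamily`∕`SFamily.Bounds`∕`opsAt`∕`ConstructionFW`∕`MapRowOnGuardedBall` into ONE Summits-side defs file; (w6)(w7) applied; lane 27930»);
`--supports stmt-QuantumFields-27930 --as helper`; count-neutral.  SOURCE OF §1–§6: ◇ lens-1 g17's cell-scratch sketch v24.1 `nodeO-cover/LENS1g17FHInterface.v2.lean`
(683d65f58319bbbc · 355 l.; v24 c8ef488a010f5f0d · 306 l. farm rc 0, ◆ CUT v24 KEEP nodeO l.6283; v24.1 = + §6 PINS (w6)(w7), ◆ nodeO l.6289 «adopt verbatim in the (c) hoist»)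
hoisted VERBATIM up to the census renames listed below; the record instantiation of the (w7) pin lives in the companion file `…PortS1FHInterfaceRecord.lean`.
[II] = [Balaban1988RG2Cluster], [I] = [Balaban1987RG1], [15] = [Balaban1985Variational], [13] = [Balaban1985BackgroundPropagators].

PRINT ([II], held `paper:balaban1988-cmp116-rg-ii-cluster`, journal page = PDF page; quoted from ◇'s materialised pages): p.2 L28–p.3 L5 «The function H_k(B′) is determined by
the propagators through the equations it satisfies. By the results of Sect. G [15] this function is given by H_k(B′) = H₀B′ + A₀ − HD(H₀B′ + A₀), (1.2) where the
linearizing transformation D(A′) is a solution of the equation D(A′) = C(A′ − HD(A′)), (1.3) and A₀ is a solution of the equation A₀ + G(δ∕δA′)V(H₀B′ + A₀) = 0. (1.4) …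
In these equations we can replace the propagators by arbitrary operators having the same regularity properties and satisfying the same bounds. Only these bounds were
important in the analysis of Sect. C, E [15], hence the solutions D, A₀ can be considered as functional of these operators» (1.5); p.3 L20–30 the s-decoupled
`H(s), G(s), H₀(s)`; p.5 (1.11) analyticity on `|s(Y₀)| ≤ e^{κ₁}` with bound `B₀e^{16κ₁}`; p.5 (1.13)–(1.14), p.6 (1.15)–(1.18).

WHAT THIS FILE TYPES (abstract complex Banach spaces; `b := B₀e^{16κ₁}` as in lit ✓`B13Sect1Arith` Part A; every `def … : Prop` DISPLAYED — asserted for nothing):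
* §1 `FHOps` (the DATA `H, H₀, G, C, W` of (1.2)–(1.4)) and **`FHOps.Bounds` = 𝔅, THE INTERFACE** ((B-op) `‖H‖, ‖H₀‖, ‖G‖ ≤ b`; (B-C) `C` analytic on `|Z| < 2ε₂`
  with `‖C Z‖ ≤ C₂‖Z‖²`; (B-W) `W` analytic on `|Z| < ε₂` with `‖W Z‖ ≤ C₄‖Z‖²` — nothing else).  COSTUME TEST (№649 (2)): no decl of §1–§5 takes the
  record `F` or any port object as an argument — 𝔅 cannot mention the record, by signature.
* §2 F_H AS PROPS OVER 𝔅: `DSolves`∕`DAnalyticBound`∕`FH1Exists` ((1.3)∕(1.14), existence + analyticity half), `A0Solves`∕`A0AnalyticBound`∕`FH2Exists` ((1.4)∕(1.16));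
  `hkFunctional` ((1.17)) and the PROVED dividends `norm_hkFunctional_le` = (1.18) over 𝔅 via ✓`B13Sect1Arith.bound_118`, `differentiableOn_hkFunctional` = (1.17)'s
  analyticity, `fh3_of_fh1_fh2` (package).
* §3 THE s-DECOUPLED EDITION: `sPolydisc`, `DecoupledOps` (`s ↦ H(s), H₀(s), G(s)`), `DecoupledOps.Bounds κ₁ B₀` = (1.11), `DecoupledOps.fhOpsAt`, `bounds_fhOpsAt`, and the
  CONSTRUCTION statement `ConstructionFW` (= F_W's target for the [13]∕[B9] lanes: (1.6)∕(1.7) = [13] (3.107)∕(3.108)), kept SEPARATE from the interface (interface ≠ existence).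
* §4 THE F4 MAP ROW, ABSTRACTLY, ON A GUARDED BALL: `MapRowOnGuardedBall Guard ι 𝒰 Uc r` (◇'s shape; port wording = def-Y (d2), see its docstring).
* §5 SANITY: the zero instance inhabits 𝔅 ∧ F_H-1 ∧ F_H-2 (the Props carry no content by themselves; content = (C-FW) + the port instance).
* §6 PINS AGAINST THE ZERO DISCHARGE (◇ v24.1, ◆ (w6)(w7), record-free): `mapRowOnGuardedBall_of_nonpos` (the `r ≤ 0` vacuity, kernel witness), `MapRowOnGuardedBallPos`
  := `0 < r ∧ MapRowOnGuardedBall …` ((w6): the radius is the content), `ConstructionFWPinned ιB ιA H₁ H H₀ G fam κ₁ B₀` := «`H₀ ∘ ιB = ιA ∘ H₁`» ∧ `ConstructionFW …` for a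
  GIVEN REAL operator `H₁` through real-linear embeddings (complexifications), and `not_constructionFWPinned_zero` (with `ιA` injective and `H₁ ≠ 0` the zero discharge fails).
* AT THE RECORD — companion file `BalabanUVNodesPortS1FHInterfaceRecord.lean` (def-Y; the only place the record is read): the complexification embeddings and
  ★`ConstructionFWAtRecord` (the (w7) pin instantiated with `H₁ := recordH1`), with RR-2's vacuity finding (OBS-1) recorded there.  THIS file is RECORD-FREE (costume test).

CENSUS RENAMES (tree-wide `rg -ow` homonym hygiene, dag-lead's standing rule; semantics unchanged): `polydisc ↦ sPolydisc`, `FH1 ↦ FH1Exists`, `FH2 ↦ FH2Exists`,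
`SFamily ↦ DecoupledOps`, `opsAt ↦ fhOpsAt`, `hk ↦ hkFunctional` (+ the lemma names built on them).

SIMPLIFICATIONS FLAGGED (◇'s (s1)–(s5), kept): (s1) ONE norm per space — print carries «all admissible norms» (Theorems 3.1–3.10 [13]); (s2) `W` is a DATUM with the
bound Prop. 4 (98) [15] gives it (in print built from `H`, `D` by (80) [15]); (s3) the polydisc is OPEN; (s4) the side conditions (I.3.31) are not typed here; (s5) uniqueness
of the fixed points is not asserted.  TYPING REMARK (★ PT-B g11): `DifferentiableOn ℂ` into a Pi∕product codomain needs only its TVS structure; matrix-valued (P4)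
`AnalyticAt` rows live under `open scoped Matrix.Norms.L2Operator` and compose with these by forgetful inheritance.

HONEST FRAMING: definitions, bookkeeping lemmas over ABSTRACT operators and zero-instance sanity∕anti-vacuity witnesses; NO instance of 𝔅 at the record exists or is claimed;
the construction statements (C-FW) are TRIVIALLY INHABITED as typed (constant families; ■ RR-2 READ 29 (6)) and acquire content only with (C-FW-loc)∕(C-FW-unif), NOT in this file; `FH1Exists`, `FH2Exists`, `ConstructionFW`∕`ConstructionFWPinned`∕`ConstructionFWAtRecord`, `MapRowOnGuardedBall(Pos)` are OPEN ∕ inhabited NOWHERE (beyond zero data); nothing of [15] Sect. C∕E∕G,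
Prop. 4, Prop. 9, [13] (3.107)∕(3.108), [II] Lemma 1 is proved or ported; F, S₃ `FEPolymerActivitiesReg`, `stub_P0C`, every P0-family letter OPEN; ⟨27930⟩ OPEN;
NODE O 0∕1; COUNT 8∕28 · K 1∕4 UNMOVED; finite `𝕋⁴_{L^K}` at fixed ε — NOT continuum ∕ OS ∕ Clay; **the Yang–Mills mass gap is NOT proved by any of this.**
No `sorry`, no `instance`, no `notation`; standard axioms.
-/

noncomputable section

namespace Summit.QuantumFields.YangMills.Theorems.BalabanUVNodesPortS1.FHInterface

open Literature.MathematicalPhysics.QuantumFieldTheory.Balaban1983to89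

variable {𝔄 𝔛 𝔅 𝔜 : Type*}
  [NormedAddCommGroup 𝔄] [NormedSpace ℂ 𝔄] [NormedAddCommGroup 𝔛] [NormedSpace ℂ 𝔛]
  [NormedAddCommGroup 𝔅] [NormedSpace ℂ 𝔅] [NormedAddCommGroup 𝔜] [NormedSpace ℂ 𝔜]

/-! ## §1  The data of (1.2)–(1.4) and the interface 𝔅 of operator bounds -/

variable (𝔄 𝔛 𝔅 𝔜) in
/-- **The DATA of [II] (1.2)–(1.4)** over abstract complex Banach spaces: `𝔄` = A-configurations (the variable of `C` and of `V`), `𝔛` = the range of the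
linearizing transformation `D` («replace the function D in (1.3) by a configuration X», p.5), `𝔅` = B′-fields, `𝔜` = currents (the range of `(δ∕δA′)V`).
[cite: Balaban1988RG2Cluster, (1.2)–(1.5) pp.2–3] -/
structure FHOps where
  /-- the propagator `H` of (1.2)∕(1.3). -/
  H : 𝔛 →L[ℂ] 𝔄
  /-- `H₀` of (1.2)∕(1.4) (`B′ ↦ H₀B′`; its real restriction at the port is the linear part ✓`recordH1` of `H_k`). -/
  H₀ : 𝔅 →L[ℂ] 𝔄
  /-- `G` of (1.4). -/
  G : 𝔜 →L[ℂ] 𝔄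
  /-- the local analytic map `C` of (1.3): `D(A′) = C(A′ − H D(A′))`. -/
  C : 𝔄 → 𝔛
  /-- `W := (δ∕δA′)V(H, ·)` of (1.4) (print's (80) [15]); a datum here (simplification (s2)). -/
  W : 𝔄 → 𝔜

/-- **𝔅 — THE INTERFACE: «the same regularity properties and … the same bounds»** ([II] p.3 L1–5), namely exactly what (1.11)–(1.16) consume:
(B-op) `‖H‖, ‖H₀‖, ‖G‖ ≤ b` ((1.11) p.5 with `b = B₀e^{16κ₁}`, «the same bound (1.11)» for `G, H₀`, p.5 L−2);
(B-C) `C` analytic on the ball `|Z| < 2ε₂` with `‖C Z‖ ≤ C₂‖Z‖²` ((1.13) p.5 = (55) [15]; the radius `2ε₂` is print's «|A| < ε₂ + B₀e^{16κ₁}4C₂ε₂² ≤ 2ε₂», (57) [15]);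
(B-W) `W` analytic on the ball `|Z| < ε₂` with `‖W Z‖ ≤ C₄‖Z‖²` ((98) Prop. 4 [15] as used in (1.15) p.6: «so the function satisfies the assumption of Proposition 4»).
[cite: Balaban1988RG2Cluster, p.3 L1–5, (1.11) p.5, (1.13) p.5, (1.15) p.6] -/
def FHOps.Bounds (O : FHOps 𝔄 𝔛 𝔅 𝔜) (b C₂ C₄ ε₂ : ℝ) : Prop :=
  (‖O.H‖ ≤ b ∧ ‖O.H₀‖ ≤ b ∧ ‖O.G‖ ≤ b) ∧
  (DifferentiableOn ℂ O.C (Metric.ball 0 (2 * ε₂)) ∧ ∀ Z : 𝔄, ‖Z‖ < 2 * ε₂ → ‖O.C Z‖ ≤ C₂ * ‖Z‖ ^ 2) ∧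
  (DifferentiableOn ℂ O.W (Metric.ball 0 ε₂) ∧ ∀ Z : 𝔄, ‖Z‖ < ε₂ → ‖O.W Z‖ ≤ C₄ * ‖Z‖ ^ 2)

/-! ## §2  F_H as Props over 𝔅: the fixed points `D`, `A₀` (existence + analyticity halves) and `H_k` -/

/-- **(1.3) solved on the ball**: `D` solves `D(A′) = C(A′ − H D(A′))` for `|A′| < ε₂`. [cite: Balaban1988RG2Cluster, (1.3) p.2, (1.13) p.5] -/
def DSolves (O : FHOps 𝔄 𝔛 𝔅 𝔜) (ε₂ : ℝ) (D : 𝔄 → 𝔛) : Prop :=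
  ∀ A' : 𝔄, ‖A'‖ < ε₂ → D A' = O.C (A' - O.H (D A'))

/-- **(1.14) + «the fixed point is an analytic function of A′»**: `D` analytic on `|A′| < ε₂` with `‖D A′‖ ≤ 4C₂‖A′‖²` (stated on the CLOSED ball, print's
«Because ε₂ can be chosen arbitrarily close to |A′|»). [cite: Balaban1988RG2Cluster, (1.14) p.5] -/
def DAnalyticBound (ε₂ C₂ : ℝ) (D : 𝔄 → 𝔛) : Prop :=
  DifferentiableOn ℂ D (Metric.ball 0 ε₂) ∧ ∀ A' : 𝔄, ‖A'‖ ≤ ε₂ → ‖D A'‖ ≤ 4 * C₂ * ‖A'‖ ^ 2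

/-- **F_H-1 — EXISTENCE half of (1.3)∕(1.14)** over 𝔅 (Banach fixed point on `{X : |X| < 4C₂ε₂²}`, [15] Sect. C; the radius arithmetic is ✓`B13Sect1Arith.radius_113`,
✓`selfmap_113`, ✓`two_eps2_114`).  OPEN as a Lean theorem; a Prop here. [cite: Balaban1988RG2Cluster, (1.13)–(1.14) p.5] -/
def FH1Exists (O : FHOps 𝔄 𝔛 𝔅 𝔜) (ε₂ C₂ : ℝ) : Prop :=
  ∃ D : 𝔄 → 𝔛, DSolves O ε₂ D ∧ DAnalyticBound ε₂ C₂ D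

/-- **(1.4) solved on the ball**: `A₀ + G W(H₀B′ + A₀) = 0` for `|B′| < ε₃`. [cite: Balaban1988RG2Cluster, (1.4) p.2, (1.15) p.6] -/
def A0Solves (O : FHOps 𝔄 𝔛 𝔅 𝔜) (ε₃ : ℝ) (A₀ : 𝔅 → 𝔄) : Prop :=
  ∀ B' : 𝔅, ‖B'‖ < ε₃ → A₀ B' + O.G (O.W (O.H₀ B' + A₀ B')) = 0

/-- **(1.16) + analyticity**: `A₀` analytic on `|B′| < ε₃` with `‖A₀ B′‖ ≤ 4C₄b³‖B′‖²`. [cite: Balaban1988RG2Cluster, (1.16) p.6] -/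
def A0AnalyticBound (ε₃ C₄ b : ℝ) (A₀ : 𝔅 → 𝔄) : Prop :=
  DifferentiableOn ℂ A₀ (Metric.ball 0 ε₃) ∧ ∀ B' : 𝔅, ‖B'‖ < ε₃ → ‖A₀ B'‖ ≤ 4 * C₄ * b ^ 3 * ‖B'‖ ^ 2

/-- **F_H-2 — EXISTENCE half of (1.4)∕(1.16)** over 𝔅 ([15] Sect. E with Prop. 4; arithmetic ✓`B13Sect1Arith.last_ineq_115`, ✓`chain_115`, ✓`chain_116`).  OPEN; a Prop here.
[cite: Balaban1988RG2Cluster, (1.15)–(1.16) p.6] -/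
def FH2Exists (O : FHOps 𝔄 𝔛 𝔅 𝔜) (ε₃ C₄ b : ℝ) : Prop :=
  ∃ A₀ : 𝔅 → 𝔄, A0Solves O ε₃ A₀ ∧ A0AnalyticBound ε₃ C₄ b A₀

/-- **(1.17)**: `H_k(B′) := H₀B′ + A₀(B′) − H D(H₀B′ + A₀(B′))`. [cite: Balaban1988RG2Cluster, (1.17) p.6, (1.2) p.2] -/
def hkFunctional (O : FHOps 𝔄 𝔛 𝔅 𝔜) (D : 𝔄 → 𝔛) (A₀ : 𝔅 → 𝔄) (B' : 𝔅) : 𝔄 :=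
  O.H₀ B' + A₀ B' - O.H (D (O.H₀ B' + A₀ B'))

/-- **(1.18) DISCHARGED OVER 𝔅** — «|H_k(s(Y₀), B′)| ≤ 4B₀e^{16κ₁}|B′|», print's first «≤» (not derived in print): from (B-op), the (1.14)-bound for `D`, the
(1.16)-bound for `A₀` and the restrictions R2 `4C₂bε₂ ≤ 1`, R3 `4C₄b²ε₃ ≤ 1`, R4 `2bε₃ ≤ ε₂`, by the tree's arithmetic ✓`B13Sect1Arith.bound_118` applied to the four
operator-norm leaves.  (The interface's teeth: the bound is a CONSEQUENCE of 𝔅, uniformly in whatever instantiates it — decoupled or not.)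
[cite: Balaban1988RG2Cluster, (1.18) p.6] -/
theorem norm_hkFunctional_le (O : FHOps 𝔄 𝔛 𝔅 𝔜) {b C₂ C₄ ε₂ ε₃ : ℝ} (hC₂ : 0 ≤ C₂) (hC₄ : 0 ≤ C₄) (hb : 0 ≤ b)
    (hR2 : 4 * C₂ * b * ε₂ ≤ 1) (hR3 : 4 * C₄ * b ^ 2 * ε₃ ≤ 1) (hR4 : 2 * b * ε₃ ≤ ε₂)
    (hH : ‖O.H‖ ≤ b) (hH₀ : ‖O.H₀‖ ≤ b) {D : 𝔄 → 𝔛} {A₀ : 𝔅 → 𝔄}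
    (hD : ∀ Z : 𝔄, ‖Z‖ ≤ ε₂ → ‖D Z‖ ≤ 4 * C₂ * ‖Z‖ ^ 2)
    (hA₀ : ∀ B' : 𝔅, ‖B'‖ < ε₃ → ‖A₀ B'‖ ≤ 4 * C₄ * b ^ 3 * ‖B'‖ ^ 2)
    (B' : 𝔅) (hB : ‖B'‖ < ε₃) :
    ‖hkFunctional O D A₀ B'‖ ≤ 4 * b * ‖B'‖ := by
  unfold hkFunctional
  set x : 𝔄 := O.H₀ B' + A₀ B' with hx_def
  have hnB0 : 0 ≤ ‖B'‖ := norm_nonneg _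
  have h1 : ‖O.H₀ B'‖ ≤ b * ‖B'‖ :=
    (O.H₀.le_opNorm B').trans (mul_le_mul_of_nonneg_right hH₀ hnB0)
  have h2 : ‖A₀ B'‖ ≤ 4 * C₄ * b ^ 3 * ‖B'‖ ^ 2 := hA₀ B' hB
  have hx : ‖x‖ ≤ ‖O.H₀ B'‖ + ‖A₀ B'‖ := by rw [hx_def]; exact norm_add_le _ _
  -- |x| ≤ 2 b |B′| < 2 b ε₃ ≤ ε₂ (print p.6 L3–5)
  have h2' : ‖A₀ B'‖ ≤ b * ‖B'‖ := by
    have e : 4 * C₄ * b ^ 3 * ‖B'‖ ^ 2 = (b * ‖B'‖) * (4 * C₄ * b ^ 2 * ‖B'‖) := by ring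
    have h' : 4 * C₄ * b ^ 2 * ‖B'‖ ≤ 1 :=
      (mul_le_mul_of_nonneg_left hB.le (by positivity)).trans hR3
    have hbn : 0 ≤ b * ‖B'‖ := mul_nonneg hb hnB0
    calc ‖A₀ B'‖ ≤ 4 * C₄ * b ^ 3 * ‖B'‖ ^ 2 := h2
      _ = (b * ‖B'‖) * (4 * C₄ * b ^ 2 * ‖B'‖) := e
      _ ≤ (b * ‖B'‖) * 1 := mul_le_mul_of_nonneg_left h' hbn
      _ = b * ‖B'‖ := mul_one _
  have hxε : ‖x‖ ≤ ε₂ := by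
    have : b * ‖B'‖ ≤ b * ε₃ := mul_le_mul_of_nonneg_left hB.le hb
    linarith
  have h3 : ‖O.H (D x)‖ ≤ b * (4 * C₂ * ‖x‖ ^ 2) :=
    (O.H.le_opNorm (D x)).trans (mul_le_mul hH (hD x hxε) (norm_nonneg _) hb)
  have h118 := B13Sect1Arith.bound_118 hC₂ hC₄ hb hnB0 hB hR2 hR3 hR4 h1 h2 (norm_nonneg x) hx h3
  calc ‖x - O.H (D x)‖ ≤ ‖x‖ + ‖O.H (D x)‖ := norm_sub_le _ _
    _ ≤ ‖O.H₀ B'‖ + ‖A₀ B'‖ + ‖O.H (D x)‖ := by linarith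
    _ ≤ 4 * b * ‖B'‖ := h118

/-- **(1.17) is analytic in B′ on `|B′| < ε₃`** from the analyticity halves of F_H-1∕F_H-2 (chain rule; the nesting `|H₀B′ + A₀(B′)| ≤ 2b|B′| < 2bε₃ ≤ ε₂` of p.6
L3–5 puts the argument of `D` inside its ball).  [cite: Balaban1988RG2Cluster, (1.17)–(1.18) p.6] -/
theorem differentiableOn_hkFunctional (O : FHOps 𝔄 𝔛 𝔅 𝔜) {b C₄ ε₂ ε₃ : ℝ} (hC₄ : 0 ≤ C₄) (hb : 0 < b)
    (hR3 : 4 * C₄ * b ^ 2 * ε₃ ≤ 1) (hR4 : 2 * b * ε₃ ≤ ε₂) (hH₀ : ‖O.H₀‖ ≤ b)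
    {D : 𝔄 → 𝔛} {A₀ : 𝔅 → 𝔄} (hDd : DifferentiableOn ℂ D (Metric.ball 0 ε₂))
    (hA₀d : DifferentiableOn ℂ A₀ (Metric.ball 0 ε₃))
    (hA₀ : ∀ B' : 𝔅, ‖B'‖ < ε₃ → ‖A₀ B'‖ ≤ 4 * C₄ * b ^ 3 * ‖B'‖ ^ 2) :
    DifferentiableOn ℂ (hkFunctional O D A₀) (Metric.ball 0 ε₃) := by
  show DifferentiableOn ℂ (fun B' : 𝔅 => O.H₀ B' + A₀ B' - O.H (D (O.H₀ B' + A₀ B'))) (Metric.ball 0 ε₃)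
  have hlin : DifferentiableOn ℂ (fun B' : 𝔅 => O.H₀ B' + A₀ B') (Metric.ball 0 ε₃) :=
    O.H₀.differentiable.differentiableOn.add hA₀d
  have hmaps : Set.MapsTo (fun B' : 𝔅 => O.H₀ B' + A₀ B') (Metric.ball 0 ε₃) (Metric.ball 0 ε₂) := by
    intro B' hB'
    rw [Metric.mem_ball, dist_zero_right] at hB'
    show O.H₀ B' + A₀ B' ∈ Metric.ball (0 : 𝔄) ε₂
    rw [Metric.mem_ball, dist_zero_right]
    have hnB0 : 0 ≤ ‖B'‖ := norm_nonneg _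
    have h1 : ‖O.H₀ B'‖ ≤ b * ‖B'‖ :=
      (O.H₀.le_opNorm B').trans (mul_le_mul_of_nonneg_right hH₀ hnB0)
    have h2' : ‖A₀ B'‖ ≤ b * ‖B'‖ := by
      have e : 4 * C₄ * b ^ 3 * ‖B'‖ ^ 2 = (b * ‖B'‖) * (4 * C₄ * b ^ 2 * ‖B'‖) := by ring
      have h' : 4 * C₄ * b ^ 2 * ‖B'‖ ≤ 1 :=
        (mul_le_mul_of_nonneg_left hB'.le (by positivity)).trans hR3
      have hbn : 0 ≤ b * ‖B'‖ := mul_nonneg hb.le hnB0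
      calc ‖A₀ B'‖ ≤ 4 * C₄ * b ^ 3 * ‖B'‖ ^ 2 := hA₀ B' hB'
        _ = (b * ‖B'‖) * (4 * C₄ * b ^ 2 * ‖B'‖) := e
        _ ≤ (b * ‖B'‖) * 1 := mul_le_mul_of_nonneg_left h' hbn
        _ = b * ‖B'‖ := mul_one _
    have hlt : 2 * b * ‖B'‖ < 2 * b * ε₃ := mul_lt_mul_of_pos_left hB' (by positivity)
    calc ‖O.H₀ B' + A₀ B'‖ ≤ ‖O.H₀ B'‖ + ‖A₀ B'‖ := norm_add_le _ _
      _ ≤ 2 * b * ‖B'‖ := by linarith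
      _ < ε₂ := by linarith
  have hcomp : DifferentiableOn ℂ (fun B' : 𝔅 => O.H (D (O.H₀ B' + A₀ B'))) (Metric.ball 0 ε₃) :=
    O.H.differentiable.comp_differentiableOn (hDd.comp hlin hmaps)
  exact hlin.sub hcomp

/-- **F_H-3 — the packaged statement print uses downstream**: under 𝔅 and R2–R4, `H_k` of (1.17) built from ANY solutions `D`, `A₀` with the (1.14)∕(1.16)
properties is analytic on `|B′| < ε₃` and satisfies (1.18).  PROVED from the two lemmas above (bookkeeping). [cite: Balaban1988RG2Cluster, (1.17)–(1.18) p.6] -/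
theorem fh3_of_fh1_fh2 (O : FHOps 𝔄 𝔛 𝔅 𝔜) {b C₂ C₄ ε₂ ε₃ : ℝ} (hC₂ : 0 ≤ C₂) (hC₄ : 0 ≤ C₄) (hb : 0 < b)
    (hR2 : 4 * C₂ * b * ε₂ ≤ 1) (hR3 : 4 * C₄ * b ^ 2 * ε₃ ≤ 1) (hR4 : 2 * b * ε₃ ≤ ε₂)
    (h𝔅 : O.Bounds b C₂ C₄ ε₂) {D : 𝔄 → 𝔛} {A₀ : 𝔅 → 𝔄}
    (hD : DAnalyticBound ε₂ C₂ D) (hA₀ : A0AnalyticBound ε₃ C₄ b A₀) :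
    DifferentiableOn ℂ (hkFunctional O D A₀) (Metric.ball 0 ε₃) ∧ ∀ B' : 𝔅, ‖B'‖ < ε₃ → ‖hkFunctional O D A₀ B'‖ ≤ 4 * b * ‖B'‖ := by
  obtain ⟨⟨hH, hH₀, _hG⟩, _hC, _hW⟩ := h𝔅
  obtain ⟨hDd, hDb⟩ := hD
  obtain ⟨hA₀d, hA₀b⟩ := hA₀
  exact ⟨differentiableOn_hkFunctional O hC₄ hb hR3 hR4 hH₀ hDd hA₀d hA₀b,
    fun B' hB => norm_hkFunctional_le O hC₂ hC₄ hb.le hR2 hR3 hR4 hH hH₀ hDb hA₀b B' hB⟩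

/-! ## §3  The s-decoupled edition (1.11) and the CONSTRUCTION statement (= F_W's target) -/

/-- The open sPolydisc `{s : |s(Δ)| < R for all Δ}` (print: `|s(Δ)| ≤ e^{κ₁}`, p.5; open here — simplification (s3)). [cite: Balaban1988RG2Cluster, p.5 L8–10] -/
def sPolydisc (σ : Type*) (R : ℝ) : Set (σ → ℂ) := {s | ∀ Δ, ‖s Δ‖ < R}

variable (𝔄 𝔛 𝔅 𝔜) in
/-- **The s-DECOUPLED OPERATOR FAMILIES** `s ↦ H(s), H₀(s), G(s)` over the cubes `σ` of the partition σ₀ ([II] p.3 L20–30: each walk term of (1.6) multiplied by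
`∏ s(Δ_i)` over the cubes its localization domain meets). Port objects: NONE today (v23 R1 (c3)). [cite: Balaban1988RG2Cluster, (1.6) p.3, p.3 L20–30] -/
structure DecoupledOps (σ : Type*) where
  /-- `s ↦ H(s)` -/
  Hs : (σ → ℂ) → (𝔛 →L[ℂ] 𝔄)
  /-- `s ↦ H₀(s)` -/
  H₀s : (σ → ℂ) → (𝔅 →L[ℂ] 𝔄)
  /-- `s ↦ G(s)` -/
  Gs : (σ → ℂ) → (𝔜 →L[ℂ] 𝔄)

/-- **(1.11) for the three families**: analytic on the sPolydisc of radius `e^{κ₁}` and bounded there by `B₀e^{16κ₁}` in operator norm («bounded by B₀e^{16κ₁}|X| in all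
norms of Theorems 3.1–3.10 [13]» — ONE norm here, simplification (s1)). [cite: Balaban1988RG2Cluster, (1.11) p.5, p.5 L−3–p.6 L1] -/
def DecoupledOps.Bounds {σ : Type*} [Fintype σ] (fam : DecoupledOps 𝔄 𝔛 𝔅 𝔜 σ) (κ₁ B₀ : ℝ) : Prop :=
  (DifferentiableOn ℂ fam.Hs (sPolydisc σ (Real.exp κ₁)) ∧ ∀ s ∈ sPolydisc σ (Real.exp κ₁), ‖fam.Hs s‖ ≤ B₀ * Real.exp (16 * κ₁)) ∧
  (DifferentiableOn ℂ fam.H₀s (sPolydisc σ (Real.exp κ₁)) ∧ ∀ s ∈ sPolydisc σ (Real.exp κ₁), ‖fam.H₀s s‖ ≤ B₀ * Real.exp (16 * κ₁)) ∧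
  (DifferentiableOn ℂ fam.Gs (sPolydisc σ (Real.exp κ₁)) ∧ ∀ s ∈ sPolydisc σ (Real.exp κ₁), ‖fam.Gs s‖ ≤ B₀ * Real.exp (16 * κ₁))

/-- The (1.2)–(1.4) data AT PARAMETER `s`: the decoupled operators with the (s-independent, local) maps `C`, `W`. [cite: Balaban1988RG2Cluster, p.4 L20–30 (bookkeeping)] -/
def DecoupledOps.fhOpsAt {σ : Type*} (fam : DecoupledOps 𝔄 𝔛 𝔅 𝔜 σ) (C : 𝔄 → 𝔛) (W : 𝔄 → 𝔜) (s : σ → ℂ) : FHOps 𝔄 𝔛 𝔅 𝔜 :=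
  ⟨fam.Hs s, fam.H₀s s, fam.Gs s, C, W⟩

/-- **At every `s` of the sPolydisc the decoupled data instantiate 𝔅** with `b = B₀e^{16κ₁}` — immediate from `DecoupledOps.Bounds` and the bounds on `C`, `W` (bookkeeping; this
is the sentence «hence the solutions D, A₀ can be considered as functional of these operators», p.3 L3–5, made checkable). [cite: Balaban1988RG2Cluster, p.3 L1–5, (1.11) p.5] -/
theorem DecoupledOps.bounds_fhOpsAt {σ : Type*} [Fintype σ] (fam : DecoupledOps 𝔄 𝔛 𝔅 𝔜 σ) {κ₁ B₀ C₂ C₄ ε₂ : ℝ} (hfam : fam.Bounds κ₁ B₀)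
    {C : 𝔄 → 𝔛} {W : 𝔄 → 𝔜}
    (hC : DifferentiableOn ℂ C (Metric.ball 0 (2 * ε₂)) ∧ ∀ Z : 𝔄, ‖Z‖ < 2 * ε₂ → ‖C Z‖ ≤ C₂ * ‖Z‖ ^ 2)
    (hW : DifferentiableOn ℂ W (Metric.ball 0 ε₂) ∧ ∀ Z : 𝔄, ‖Z‖ < ε₂ → ‖W Z‖ ≤ C₄ * ‖Z‖ ^ 2)
    {s : σ → ℂ} (hs : s ∈ sPolydisc σ (Real.exp κ₁)) :
    (fam.fhOpsAt C W s).Bounds (B₀ * Real.exp (16 * κ₁)) C₂ C₄ ε₂ := by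
  obtain ⟨⟨_, hH⟩, ⟨_, hH₀⟩, ⟨_, hG⟩⟩ := hfam
  unfold FHOps.Bounds DecoupledOps.fhOpsAt
  exact ⟨⟨hH s hs, hH₀ s hs, hG s hs⟩, hC, hW⟩

/-- **CONSTRUCTION (C-FW) — F_W's TARGET, as a SHAPE**: «the port's propagators `H, H₀, G` admit s-decoupled families satisfying (1.11) and coinciding with the originals
at `s = 1`» ([II] p.3 L20–30, (1.6)∕(1.7) = [13] (3.107)∕(3.108)).  The three operators and the family are ARGUMENTS: the port has no names for them today (v23 (c3);
`H₀`'s real restriction = ✓`recordH1`).  OPEN; nothing instantiates it. [cite: Balaban1988RG2Cluster, (1.6)–(1.7) p.3, (1.11) p.5] -/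
def ConstructionFW {σ : Type*} [Fintype σ] (H : 𝔛 →L[ℂ] 𝔄) (H₀ : 𝔅 →L[ℂ] 𝔄) (G : 𝔜 →L[ℂ] 𝔄)
    (fam : DecoupledOps 𝔄 𝔛 𝔅 𝔜 σ) (κ₁ B₀ : ℝ) : Prop :=
  fam.Hs 1 = H ∧ fam.H₀s 1 = H₀ ∧ fam.Gs 1 = G ∧ fam.Bounds κ₁ B₀

/-- Sanity (bookkeeping): `s = 1` lies in the sPolydisc as soon as `κ₁ > 0`, so (C-FW) delivers 𝔅 for the ORIGINAL operators too. [cite: Balaban1988RG2Cluster, p.3 L29–30 (bookkeeping)] -/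
theorem one_mem_sPolydisc (σ : Type*) {κ₁ : ℝ} (hκ : 0 < κ₁) : (1 : σ → ℂ) ∈ sPolydisc σ (Real.exp κ₁) := by
  show ∀ Δ : σ, ‖(1 : σ → ℂ) Δ‖ < Real.exp κ₁
  intro Δ
  rw [Pi.one_apply, norm_one]
  linarith [Real.add_one_lt_exp (ne_of_gt hκ)]

/-! ## §4  The F4 MAP row, abstractly, on a guarded ball ([I] Lemma 4 (3.53) p.280 ⇐ [15] Prop. 9) -/

/-- **F4, ABSTRACT SHAPE — «the map has a complex-analytic extension on the ball, with values in U^c, UNDER THE GUARD»**: a real map `𝒰 : 𝔅r → Cfg` (configurations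
read in complex coordinates), the complexification `ι : 𝔅r →L[ℝ] 𝔅c` of its argument space, a target set `Uc ⊆ Cfg` and a radius `r`.  [I] Lemma 4 (3.53): «(U_j(□₀,
exp i(τB + A′)), J_j(□₀, ·))|_X ∈ U^c_j(X, α₀, α₁) … The functions in (3.53) are analytic» on |τ| < the (3.53) radius.
PORT WORDING — UNDECIDED → def-Y (d2), for this reason: at the port `𝒰` is a `Classical.choose` selector (✓`UkSel` ∕ ✓`recordBgField`, `…K0RecordFormatNames` :344)
under `UkExists ∧ UniqueUkOrbit`, so the row must be PREFIXED by the guard of ✓`P0HolExtAtRecordGL` (`…P0CGuardedL` :64) — else it is junk-inhabited ∕ vacuous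
(v22 D-5: `junk_not_smallTheta`); and what it adds to S₃'s antecedent token `hP9 : AnalyticAt ℝ (B ↦ recordBgField …) 0` (a GERM, which already yields SOME complex
extension near 0) is exactly a QUANTIFIED radius `r` (print's (3.53)) and the LOCATED range `Uc = recordUc F Mc j α₀ α₁ K X` — those two data are the content
def-Y (d2) must word with the record's scales; I do not guess them here. [cite: Balaban1987RG1, Lemma 4 (3.53)–(3.54) p.280; Balaban1988RG2Cluster, p.7 L−8–−1] -/
def MapRowOnGuardedBall {𝔅r 𝔅c Cfg : Type*} [NormedAddCommGroup 𝔅r] [NormedSpace ℝ 𝔅r]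
    [NormedAddCommGroup 𝔅c] [NormedSpace ℂ 𝔅c] [NormedAddCommGroup Cfg] [NormedSpace ℂ Cfg]
    (Guard : Prop) (ι : 𝔅r →L[ℝ] 𝔅c) (𝒰 : 𝔅r → Cfg) (Uc : Set Cfg) (r : ℝ) : Prop :=
  Guard → ∃ 𝒰c : 𝔅c → Cfg, DifferentiableOn ℂ 𝒰c (Metric.ball 0 r) ∧ Set.MapsTo 𝒰c (Metric.ball 0 r) Uc ∧
    ∀ B : 𝔅r, ‖B‖ < r → 𝒰c (ι B) = 𝒰 B

/-! ## §5  Sanity: 𝔅 ∧ F_H-1 ∧ F_H-2 is CONSISTENT (the zero instance) — the Props are not vacuously consumable; content enters only via (C-FW) -/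

/-- The zero data (all operators and local maps zero). [cite: Balaban1988RG2Cluster, (1.2)–(1.4) p.2 (bookkeeping witness)] -/
def FHOps.zero : FHOps 𝔄 𝔛 𝔅 𝔜 := ⟨0, 0, 0, fun _ => 0, fun _ => 0⟩

/-- The zero data satisfy 𝔅 for any nonnegative constants. [cite: Balaban1988RG2Cluster, p.3 L1–5 (bookkeeping witness)] -/
theorem FHOps.zero_bounds {b C₂ C₄ : ℝ} (ε₂ : ℝ) (hb : 0 ≤ b) (hC₂ : 0 ≤ C₂) (hC₄ : 0 ≤ C₄) :
    (FHOps.zero : FHOps 𝔄 𝔛 𝔅 𝔜).Bounds b C₂ C₄ ε₂ := by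
  unfold FHOps.Bounds FHOps.zero
  refine ⟨⟨?_, ?_, ?_⟩, ⟨differentiableOn_const _, fun Z _ => ?_⟩, ⟨differentiableOn_const _, fun Z _ => ?_⟩⟩
  · simp only [norm_zero]; exact hb
  · simp only [norm_zero]; exact hb
  · simp only [norm_zero]; exact hb
  · simp only [norm_zero]; positivity
  · simp only [norm_zero]; positivity

/-- F_H-1 holds for the zero data with `D = 0`. [cite: Balaban1988RG2Cluster, (1.14) p.5 (bookkeeping witness)] -/
theorem FHOps.zero_fh1Exists (ε₂ : ℝ) {C₂ : ℝ} (hC₂ : 0 ≤ C₂) : FH1Exists (FHOps.zero : FHOps 𝔄 𝔛 𝔅 𝔜) ε₂ C₂ := by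
  unfold FH1Exists DSolves DAnalyticBound FHOps.zero
  refine ⟨fun _ => 0, fun A' _ => rfl, differentiableOn_const _, fun A' _ => ?_⟩
  simp only [norm_zero]; positivity

/-- F_H-2 holds for the zero data with `A₀ = 0`. [cite: Balaban1988RG2Cluster, (1.16) p.6 (bookkeeping witness)] -/
theorem FHOps.zero_fh2Exists (ε₃ : ℝ) {C₄ b : ℝ} (hC₄ : 0 ≤ C₄) (hb : 0 ≤ b) : FH2Exists (FHOps.zero : FHOps 𝔄 𝔛 𝔅 𝔜) ε₃ C₄ b := by
  unfold FH2Exists A0Solves A0AnalyticBound FHOps.zero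
  refine ⟨fun _ => 0, fun B' _ => ?_, differentiableOn_const _, fun B' _ => ?_⟩
  · simp only [map_zero, add_zero]
  · simp only [norm_zero]; positivity

/-! ## §6  (v24.1 — ◆ CUT v24 l.6283 (w6)(w7)) PINS AGAINST THE ZERO DISCHARGE

◆ (4): «§5's ZERO instance inhabits 𝔅 ∧ FH1Exists ∧ FH2Exists, AND `ConstructionFW 0 0 0 ⟨0,0,0⟩ κ₁ B₀` holds for any B₀ ≥ 0 — so the typed layer is CONTENTLESS until its ARGUMENTS are the port's operators;
hence (w7): at hoist time def-Y must PIN at least `H₀`'s real restriction to ✓`recordH1` in the construction statement's signature, else a zero discharge of (C-FW) type-checks; and (w6):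
`MapRowOnGuardedBall Guard ι 𝒰 Uc r` is trivially inhabited at `r ≤ 0` (empty ball) and at `¬Guard` — the (d2) row must carry `0 < r`.»  Typed here, record-free (the real operator `H₁` is an
ARGUMENT; def-Y instantiates `H₁ := recordH1 F … k K` with `ιB`, `ιA` the complexification embeddings of the real fluctuation ∕ configuration charts). -/

section Pins

/-- (w6-witness) ◆'s remark, kernel-checked: at a NON-POSITIVE radius the unpinned F4 row holds trivially (empty ball). [cite: Balaban1987RG1, Lemma 4 (3.53) p.280 (the radius is the content)] -/
theorem mapRowOnGuardedBall_of_nonpos {𝔅r 𝔅c Cfg : Type*} [NormedAddCommGroup 𝔅r] [NormedSpace ℝ 𝔅r] [NormedAddCommGroup 𝔅c] [NormedSpace ℂ 𝔅c]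
    [NormedAddCommGroup Cfg] [NormedSpace ℂ Cfg] (Guard : Prop) (ι : 𝔅r →L[ℝ] 𝔅c) (𝒰 : 𝔅r → Cfg) (Uc : Set Cfg) {r : ℝ} (hr : r ≤ 0) :
    MapRowOnGuardedBall Guard ι 𝒰 Uc r := by
  intro _
  have hball : Metric.ball (0 : 𝔅c) r = ∅ := Metric.ball_eq_empty.mpr hr
  refine ⟨fun _ => 0, ?_, ?_, ?_⟩
  · rw [hball]; exact differentiableOn_empty
  · rw [hball]; exact Set.mapsTo_empty _ _
  · intro B hB
    exact absurd (lt_of_le_of_lt (norm_nonneg B) (lt_of_lt_of_le hB hr)) (lt_irrefl 0)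

/-- **(w6) THE F4 ROW WITH ITS RADIUS PINNED POSITIVE** — the shape def-Y's (d2) row should instantiate (under the GL guard): `0 < r ∧ (Guard → ∃ 𝒰ᶜ analytic on the r-ball, into U^c, extending 𝒰)`;
print's r is the QUANTIFIED radius of (3.53). [cite: Balaban1987RG1, Lemma 4 (3.47)–(3.53) pp.278–280] -/
def MapRowOnGuardedBallPos {𝔅r 𝔅c Cfg : Type*} [NormedAddCommGroup 𝔅r] [NormedSpace ℝ 𝔅r] [NormedAddCommGroup 𝔅c] [NormedSpace ℂ 𝔅c]
    [NormedAddCommGroup Cfg] [NormedSpace ℂ Cfg] (Guard : Prop) (ι : 𝔅r →L[ℝ] 𝔅c) (𝒰 : 𝔅r → Cfg) (Uc : Set Cfg) (r : ℝ) : Prop :=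
  0 < r ∧ MapRowOnGuardedBall Guard ι 𝒰 Uc r

/-- **(w7) THE CONSTRUCTION STATEMENT WITH `H₀` PINNED TO A GIVEN REAL OPERATOR `H₁`** through real-linear embeddings `ιB : 𝔅ʳ → 𝔅`, `ιA : 𝔄ʳ → 𝔄` (complexifications): `H₀ ∘ ιB = ιA ∘ H₁` ∧ `ConstructionFW …`.
At the port `H₁ := recordH1 …` ([I] (2.20)'s `H₁`, ✓ in tree, REAL); the pin is what makes a zero discharge of (C-FW) impossible (next lemma). [cite: Balaban1988RG2Cluster, (1.2), (1.11) pp.2–5; Balaban1987RG1, (2.20) p.268] -/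
def ConstructionFWPinned {σ : Type*} [Fintype σ] {𝔅r 𝔄r : Type*} [NormedAddCommGroup 𝔅r] [NormedSpace ℝ 𝔅r] [NormedAddCommGroup 𝔄r] [NormedSpace ℝ 𝔄r]
    (ιB : 𝔅r →L[ℝ] 𝔅) (ιA : 𝔄r →L[ℝ] 𝔄) (H₁ : 𝔅r →L[ℝ] 𝔄r)
    (H : 𝔛 →L[ℂ] 𝔄) (H₀ : 𝔅 →L[ℂ] 𝔄) (G : 𝔜 →L[ℂ] 𝔄) (fam : DecoupledOps 𝔄 𝔛 𝔅 𝔜 σ) (κ₁ B₀ : ℝ) : Prop :=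
  (∀ B : 𝔅r, H₀ (ιB B) = ιA (H₁ B)) ∧ ConstructionFW H H₀ G fam κ₁ B₀

/-- (w7-witness) With `ιA` injective and `H₁ ≠ 0`, the pinned construction statement is NOT satisfied by `H₀ = 0` — the zero discharge no longer type-checks as a proof.
[cite: Balaban1988RG2Cluster, (1.11) p.5 (bookkeeping witness)] -/
theorem not_constructionFWPinned_zero {σ : Type*} [Fintype σ] {𝔅r 𝔄r : Type*} [NormedAddCommGroup 𝔅r] [NormedSpace ℝ 𝔅r] [NormedAddCommGroup 𝔄r] [NormedSpace ℝ 𝔄r]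
    (ιB : 𝔅r →L[ℝ] 𝔅) {ιA : 𝔄r →L[ℝ] 𝔄} (hιA : Function.Injective ιA) {H₁ : 𝔅r →L[ℝ] 𝔄r} (hH₁ : H₁ ≠ 0)
    (H : 𝔛 →L[ℂ] 𝔄) (G : 𝔜 →L[ℂ] 𝔄) (fam : DecoupledOps 𝔄 𝔛 𝔅 𝔜 σ) (κ₁ B₀ : ℝ) :
    ¬ ConstructionFWPinned ιB ιA H₁ H 0 G fam κ₁ B₀ := by
  rintro ⟨hpin, -⟩
  apply hH₁
  ext B
  apply hιA
  rw [← hpin B]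
  simp

end Pins

end Summit.QuantumFields.YangMills.Theorems.BalabanUVNodesPortS1.FHInterface
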